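import Mathlib
import HarnessLib
import Summits.HubbardSuperconductivity.HubbardSuperconductivity.Theorems.KLProgrammePerturbedFermiCurveDefs
import Summits.HubbardSuperconductivity.HubbardSuperconductivity.Theorems.KLProgrammeKLRegimeSplitCounterMap
import Summits.HubbardSuperconductivity.HubbardSuperconductivity.Theorems.KLProgrammeKLRegimeSplitGenericV3

/-!
# Route `KLProgramme` — crux K1 `H10TwoPointLimit` (stmt-HubbardSuperconductivity-19938) / K3's ENGINE child:
# a `C₄ᵥ` frame as a `C²`-small perturbation of the free band on `Fin 2 → ℝ` — the plumbing between the cell's frame predicates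
# (`FrameGeometry` / `FrameOK` on `Momentum`) and the p4 lineage's moving-curve counting hypotheses (`δ` on `Fin 2 → ℝ`)

Cell `gate-hubbard-kl`, seat p4 (C5a lead), g5; HOME/prover-p4/PORT-NOTE.md §7 (c).  In the counterterm scheme of K3's children the
interacting Fermi curve held fixed along the flow is the zero set `{frameLevel μ K = 0}` = `{ε₀ − K = μ}` of an ADMISSIBLE frame `K`
(`FrameOK R U (nScales β) μ K`); the lineage's counting theorems (`countPairs_perturbed`, `offsetSectorCount_perturbed_slack`,
`relCount_lastLeg_perturbedCurve_le`) take a `C²` even `2πℤ²`-periodic `δ : (Fin 2 → ℝ) → ℝ` with `|δ|, ‖Dδ‖, ‖D²δ‖ ≤ κ`.  This file is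
the dictionary for `δ_K(k) := frameShift K (toLp 2 k) = -K(k)`:

* §1 `δ_K` is smooth, even, `2πℤ²`-periodic (`TrigPolyC4v.eval_neg/eval_periodic`); its sizes on `Fin 2 → ℝ` from the frame's `C²` size
  `A` on `Momentum` (`‖Dʲ(frameShift K)‖ ≤ A`, `j ≤ 2` — the fourth clause of `FrameGeometry`): `|δ_K| ≤ A`, `‖Dδ_K‖ ≤ 2A`, `‖D²δ_K‖ ≤ 4A`
  (`ContinuousLinearMap.iteratedFDeriv_comp_right` with `‖toLp‖ ≤ 2`), so the three counting hypotheses hold with `κ` once `4A ≤ κ`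
  (`frameShift_toLp_small`); `frameLevel μ K (toLp k) = ε₀(k) + δ_K(k) − μ` (`frameLevel_toLp`).
* §2 a root selection of the frame's curve exists (`isBandFermiRadius_perturbedFermiRadius_frame`) and `frameLevel` vanishes on it.
* §3 the `C²` size of an ADMISSIBLE frame: `FrameOK R U N μ K ⇒ A ≤ 2·Gfr 0·|U| + 2·Gfr 1·U² + Gfr 2·U²·(N+1)` (geometric sums of the
  piece bounds at orders `0, 1`; linear in the number of scales at order `2`, BGM (2.36)); IN THE KL REGIME `klBetaMin ≤ β ≤ e^{c/U²}`
  (`U²(nScales β + 1) ≤ c/log 4`): `A ≤ 2·Gfr 0·|U| + 2·Gfr 1·U² + Gfr 2·c/log 4`, and thresholds `c₃(R, κ)`, `U₀(R, κ)` making `4A ≤ κ`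
  (`frame_thresholds`) — the shape of Δ17's `EngineP4` (`c ≤ c₃`).
The counting theorems on frames are in `KLProgrammeH10TwoPointLimitFrameSectorCount.lean`.  Everything is PROVED; no definitions, no
named facts.  References: BGM 2006 Lemma 2.1 / (2.36) [cite: BenfattoGiulianiMastropietro2006]; FST II Lemma 2.1
[cite: FeldmanSalmhoferTrubowitz1998]; HOME/prover-p4/PORT-NOTE.md §7(c).
-/

noncomputable section

namespace Summit.HubbardSuperconductivity.HubbardSuperconductivity.Theorems.PerturbedFermiCurve

set_option linter.dupNamespace false -- summit = problem name (single-conjunct summit), D-0017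

open Classical
open Real Set Finset
open Literature.MathematicalPhysics.QuantumLattice Literature.MathematicalPhysics.QuantumLattice.BandSectorCounting
open Summit.HubbardSuperconductivity.HubbardSuperconductivity.Theorems.DispersionFlow
open Summit.HubbardSuperconductivity.HubbardSuperconductivity.Theorems.KLRegimeSplit

/-! ## §1 Plumbing: the frame as a perturbation on `Fin 2 → ℝ` -/

/-- `‖toLp 2 v‖ ≤ 2‖v‖` (`ℓ²` vs `sup` norm on `ℝ²`; `√2` would do). [folklore] -/
theorem norm_toLp_two_le (v : Fin 2 → ℝ) : ‖(WithLp.toLp 2 v : Momentum)‖ ≤ 2 * ‖v‖ := by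
  rw [EuclideanSpace.norm_eq]
  have h0 : ∀ i, ‖(WithLp.toLp 2 v : Momentum) i‖ ≤ ‖v‖ := fun i => by
    simpa using norm_le_pi_norm v i
  have hs : ∑ i, ‖(WithLp.toLp 2 v : Momentum) i‖ ^ 2 ≤ (2 * ‖v‖) ^ 2 := by
    rw [Fin.sum_univ_two]
    nlinarith [h0 0, h0 1, norm_nonneg ((WithLp.toLp 2 v : Momentum) 0), norm_nonneg ((WithLp.toLp 2 v : Momentum) 1),
      norm_nonneg v]
  calc Real.sqrt (∑ i, ‖(WithLp.toLp 2 v : Momentum) i‖ ^ 2) ≤ Real.sqrt ((2 * ‖v‖) ^ 2) := Real.sqrt_le_sqrt hs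
    _ = 2 * ‖v‖ := Real.sqrt_sq (by positivity)

/-- The operator norm of `toLp 2 : (Fin 2 → ℝ) →L[ℝ] Momentum` is `≤ 2`. [folklore] -/
theorem norm_toLpCLM_le : ‖((EuclideanSpace.equiv (Fin 2) ℝ).symm : (Fin 2 → ℝ) →L[ℝ] Momentum)‖ ≤ 2 :=
  ContinuousLinearMap.opNorm_le_bound _ (by norm_num) fun v => by
    simpa using norm_toLp_two_le v

/-- `δ_K = frameShift K ∘ toLp` as a composition with the continuous linear map `toLp`. -/
theorem frameShift_toLp_eq_comp (K : TrigPolyC4v) :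
    (fun k : Fin 2 → ℝ => frameShift K (WithLp.toLp 2 k)) =
      frameShift K ∘ ⇑((EuclideanSpace.equiv (Fin 2) ℝ).symm : (Fin 2 → ℝ) →L[ℝ] Momentum) := by
  funext k; simp

/-- `δ_K(k) = -K(k)`. -/
@[simp] theorem frameShift_toLp (K : TrigPolyC4v) (k : Fin 2 → ℝ) : frameShift K (WithLp.toLp 2 k) = -K.eval k := rfl

/-- The frame correction is smooth on `Momentum`. -/
theorem contDiff_frameShift (K : TrigPolyC4v) {m : WithTop ℕ∞} : ContDiff ℝ m (frameShift K) :=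
  (contDiff_evalM K).neg

/-- `δ_K` is `C²` (indeed smooth) on `Fin 2 → ℝ`. -/
theorem contDiff_frameShift_toLp (K : TrigPolyC4v) {m : WithTop ℕ∞} :
    ContDiff ℝ m (fun k : Fin 2 → ℝ => frameShift K (WithLp.toLp 2 k)) := by
  rw [frameShift_toLp_eq_comp]
  exact (contDiff_frameShift K).comp ((EuclideanSpace.equiv (Fin 2) ℝ).symm : (Fin 2 → ℝ) →L[ℝ] Momentum).contDiff

/-- `δ_K` is continuous on `Fin 2 → ℝ`. -/
theorem continuous_frameShift_toLp (K : TrigPolyC4v) : Continuous (fun k : Fin 2 → ℝ => frameShift K (WithLp.toLp 2 k)) :=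
  (contDiff_frameShift_toLp K (m := 0)).continuous

/-- `δ_K` is differentiable on `Fin 2 → ℝ`. -/
theorem differentiable_frameShift_toLp (K : TrigPolyC4v) :
    Differentiable ℝ (fun k : Fin 2 → ℝ => frameShift K (WithLp.toLp 2 k)) :=
  (contDiff_frameShift_toLp K (m := 1)).differentiable (by norm_num)

/-- `δ_K` is even (`C₄ᵥ` symmetry contains the inversion). -/
theorem frameShift_toLp_neg (K : TrigPolyC4v) (k : Fin 2 → ℝ) :
    frameShift K (WithLp.toLp 2 (-k)) = frameShift K (WithLp.toLp 2 k) := by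
  rw [frameShift_toLp, frameShift_toLp, TrigPolyC4v.eval_neg]

/-- `δ_K` is `2πℤ²`-periodic. -/
theorem frameShift_toLp_periodic (K : TrigPolyC4v) (k : Fin 2 → ℝ) (m : Fin 2 → ℤ) :
    frameShift K (WithLp.toLp 2 (fun i => k i + 2 * π * m i)) = frameShift K (WithLp.toLp 2 k) := by
  have h := TrigPolyC4v.eval_periodic K k m
  have e : (fun i => k i + 2 * π * (m i : ℝ)) = fun i => k i + m i * (2 * π) := by
    funext i; ring
  simp only [frameShift_toLp, e, h]

/-- **The `C²` sizes of `δ_K` on `Fin 2 → ℝ` from the frame's `C²` size on `Momentum`**: if `‖Dʲ(frameShift K)(p)‖ ≤ A` for `j ≤ 2`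
(the fourth clause of `FrameGeometry`), then `‖Dʲ δ_K(k)‖ ≤ A·2ʲ` (`Dʲ(f ∘ T) = Dʲf ∘ (T, …, T)`, `‖T‖ ≤ 2`). -/
theorem norm_iteratedFDeriv_frameShift_toLp_le {K : TrigPolyC4v} {A : ℝ}
    (hA : ∀ p : Momentum, ∀ j ≤ 2, ‖iteratedFDeriv ℝ j (frameShift K) p‖ ≤ A) (k : Fin 2 → ℝ) {j : ℕ} (hj : j ≤ 2) :
    ‖iteratedFDeriv ℝ j (fun k : Fin 2 → ℝ => frameShift K (WithLp.toLp 2 k)) k‖ ≤ A * 2 ^ j := by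
  set T := ((EuclideanSpace.equiv (Fin 2) ℝ).symm : (Fin 2 → ℝ) →L[ℝ] Momentum) with hT
  have hC : ContDiff ℝ 2 (frameShift K) := contDiff_frameShift K
  rw [frameShift_toLp_eq_comp, ContinuousLinearMap.iteratedFDeriv_comp_right T hC k (by exact_mod_cast hj)]
  have h1 := ContinuousMultilinearMap.norm_compContinuousLinearMap_le (iteratedFDeriv ℝ j (frameShift K) (T k))
    (fun _ : Fin j => T)
  have hA0 : 0 ≤ A := le_trans (norm_nonneg _) (hA (T k) 0 (by norm_num))
  calc _ ≤ ‖iteratedFDeriv ℝ j (frameShift K) (T k)‖ * ∏ _i : Fin j, ‖T‖ := h1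
    _ ≤ A * 2 ^ j := by
        rw [Finset.prod_const, Finset.card_univ, Fintype.card_fin]
        exact mul_le_mul (hA _ j hj) (pow_le_pow_left₀ (norm_nonneg _) norm_toLpCLM_le j) (by positivity) hA0

/-- `|δ_K| ≤ A`. -/
theorem abs_frameShift_toLp_le {K : TrigPolyC4v} {A : ℝ}
    (hA : ∀ p : Momentum, ∀ j ≤ 2, ‖iteratedFDeriv ℝ j (frameShift K) p‖ ≤ A) (k : Fin 2 → ℝ) :
    |frameShift K (WithLp.toLp 2 k)| ≤ A := by
  have h := norm_iteratedFDeriv_frameShift_toLp_le hA k (j := 0) (by norm_num)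
  rw [norm_iteratedFDeriv_zero, Real.norm_eq_abs, pow_zero, mul_one] at h
  exact h

/-- `‖Dδ_K‖ ≤ 2A`. -/
theorem norm_fderiv_frameShift_toLp_le {K : TrigPolyC4v} {A : ℝ}
    (hA : ∀ p : Momentum, ∀ j ≤ 2, ‖iteratedFDeriv ℝ j (frameShift K) p‖ ≤ A) (k : Fin 2 → ℝ) :
    ‖fderiv ℝ (fun k : Fin 2 → ℝ => frameShift K (WithLp.toLp 2 k)) k‖ ≤ 2 * A := by
  have h := norm_iteratedFDeriv_frameShift_toLp_le hA k (j := 1) (by norm_num)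
  rw [norm_iteratedFDeriv_one, pow_one] at h
  linarith

/-- `‖D²δ_K‖ ≤ 4A`. -/
theorem norm_fderiv_fderiv_frameShift_toLp_le {K : TrigPolyC4v} {A : ℝ}
    (hA : ∀ p : Momentum, ∀ j ≤ 2, ‖iteratedFDeriv ℝ j (frameShift K) p‖ ≤ A) (k : Fin 2 → ℝ) :
    ‖fderiv ℝ (fderiv ℝ (fun k : Fin 2 → ℝ => frameShift K (WithLp.toLp 2 k))) k‖ ≤ 4 * A := by
  have h := norm_iteratedFDeriv_frameShift_toLp_le hA k (j := 2) le_rfl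
  rw [← norm_iteratedFDeriv_fderiv, norm_iteratedFDeriv_one] at h
  linarith

/-- **The three perturbation-size hypotheses of the lineage's counting theorems hold for `δ_K` with `κ` once `4A ≤ κ`.** -/
theorem frameShift_toLp_small {K : TrigPolyC4v} {A κ : ℝ}
    (hA : ∀ p : Momentum, ∀ j ≤ 2, ‖iteratedFDeriv ℝ j (frameShift K) p‖ ≤ A) (hκ : 4 * A ≤ κ) :
    (∀ k : Fin 2 → ℝ, |frameShift K (WithLp.toLp 2 k)| ≤ κ) ∧
    (∀ k : Fin 2 → ℝ, ‖fderiv ℝ (fun k : Fin 2 → ℝ => frameShift K (WithLp.toLp 2 k)) k‖ ≤ κ) ∧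
    (∀ k : Fin 2 → ℝ, ‖fderiv ℝ (fderiv ℝ (fun k : Fin 2 → ℝ => frameShift K (WithLp.toLp 2 k))) k‖ ≤ κ) := by
  have hA0 : 0 ≤ A := le_trans (norm_nonneg _) (hA 0 0 (by norm_num))
  exact ⟨fun k => (abs_frameShift_toLp_le hA k).trans (by linarith),
    fun k => (norm_fderiv_frameShift_toLp_le hA k).trans (by linarith),
    fun k => (norm_fderiv_fderiv_frameShift_toLp_le hA k).trans (by linarith)⟩

/-- **The frame's level function on `Fin 2 → ℝ`**: `e_K(toLp k) = ε₀(k) + δ_K(k) − μ`. -/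
theorem frameLevel_toLp (μ : ℝ) (K : TrigPolyC4v) (k : Fin 2 → ℝ) :
    frameLevel μ K (WithLp.toLp 2 k) = sqDispersion k + frameShift K (WithLp.toLp 2 k) - μ := by
  simp only [frameLevel, frameShift_toLp, squareDispersion_one_zero_eq_sqDispersion]
  ring

/-! ## §2 A root selection of the frame's curve exists -/

/-- **The polar graph of a frame's Fermi curve**: for a frame with `C²` size `A` and `[μ − A, μ + A] ⊂ [a, b] ⊂ (-4, 0)`, the lineage's
`perturbedFermiRadius δ_K μ` is a root selection of `{ε₀ + δ_K = μ}` = `{frameLevel μ K = 0}` on every ray. -/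
theorem isBandFermiRadius_perturbedFermiRadius_frame {a b : ℝ} (B : BandBounds a b) {K : TrigPolyC4v} {A : ℝ}
    (hA : ∀ p : Momentum, ∀ j ≤ 2, ‖iteratedFDeriv ℝ j (frameShift K) p‖ ≤ A) {μ : ℝ} (hlo : a ≤ μ - A) (hhi : μ + A ≤ b) (θ : ℝ) :
    IsBandFermiRadius (μ - frameShift K (WithLp.toLp 2
        (perturbedFermiRadius (fun k : Fin 2 → ℝ => frameShift K (WithLp.toLp 2 k)) μ θ • dir θ))) θ
      (perturbedFermiRadius (fun k : Fin 2 → ℝ => frameShift K (WithLp.toLp 2 k)) μ θ) :=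
  isBandFermiRadius_perturbedFermiRadius B (continuous_frameShift_toLp K)
    (fun k _ => abs_frameShift_toLp_le hA k) hlo hhi θ

/-- **The frame's curve is the zero set of `frameLevel`** along the polar graph: `frameLevel μ K (toLp (u_K(θ)·dir θ)) = 0`. -/
theorem frameLevel_perturbedFermiRadius_eq_zero {a b : ℝ} (B : BandBounds a b) {K : TrigPolyC4v} {A : ℝ}
    (hA : ∀ p : Momentum, ∀ j ≤ 2, ‖iteratedFDeriv ℝ j (frameShift K) p‖ ≤ A) {μ : ℝ} (hlo : a ≤ μ - A) (hhi : μ + A ≤ b) (θ : ℝ) :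
    frameLevel μ K (WithLp.toLp 2
      (perturbedFermiRadius (fun k : Fin 2 → ℝ => frameShift K (WithLp.toLp 2 k)) μ θ • dir θ)) = 0 := by
  have h := sqDispersion_add_perturbedFermiRadius B (continuous_frameShift_toLp K)
    (fun k _ => abs_frameShift_toLp_le hA k) hlo hhi θ
  simp only at h
  rw [frameLevel_toLp]
  linarith

/-! ## §3 The `C²` size of an admissible frame: `FrameGeometry`, `FrameOK`, and the KL regime -/

/-- The `C²` size clause is the fourth component of `FrameGeometry a₀ a₁ A b ē μ K`. -/
theorem frameSize_of_frameGeometry {a₀ a₁ A b ebar μ : ℝ} {K : TrigPolyC4v} (h : FrameGeometry a₀ a₁ A b ebar μ K) :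
    ∀ p : Momentum, ∀ j ≤ 2, ‖iteratedFDeriv ℝ j (frameShift K) p‖ ≤ A :=
  h.2.2.2.1

/-- A finite geometric sum is below the series. [folklore] -/
theorem sum_pow_le_inv_one_sub {r : ℝ} (h0 : 0 ≤ r) (h1 : r < 1) (N : ℕ) :
    ∑ n ∈ range N, r ^ n ≤ (1 - r)⁻¹ :=
  sum_le_hasSum (range N) (fun n _ => pow_nonneg h0 n) (hasSum_geometric_of_lt_one h0 h1)

/-- `4^{(j-2)n} ≤ (1/4)^n` for `j ≤ 1`. [folklore] -/
theorem four_zpow_le_quarter_pow {j n : ℕ} (hj : j ≤ 1) :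
    (4 : ℝ) ^ (((j : ℤ) - 2) * n) ≤ (1 / 4 : ℝ) ^ n := by
  have h1 : ((j : ℤ) - 2) * n ≤ -(n : ℤ) := by
    have : (j : ℤ) ≤ 1 := by exact_mod_cast hj
    nlinarith [Int.natCast_nonneg n]
  calc (4 : ℝ) ^ (((j : ℤ) - 2) * n) ≤ (4 : ℝ) ^ (-(n : ℤ)) := zpow_le_zpow_right₀ (by norm_num) h1
    _ = (1 / 4 : ℝ) ^ n := by rw [zpow_neg, zpow_natCast, one_div, inv_pow]

/-- `Σ_{n ≤ N} 4^{(j-2)n} ≤ 2` for `j ≤ 1` (`16/15` resp. `4/3`). [folklore] -/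
theorem sum_four_zpow_le_two {j : ℕ} (hj : j ≤ 1) (N : ℕ) :
    ∑ n ∈ range (N + 1), (4 : ℝ) ^ (((j : ℤ) - 2) * n) ≤ 2 := by
  calc _ ≤ ∑ n ∈ range (N + 1), (1 / 4 : ℝ) ^ n := sum_le_sum fun n _ => four_zpow_le_quarter_pow hj
    _ ≤ (1 - 1 / 4 : ℝ)⁻¹ := sum_pow_le_inv_one_sub (by norm_num) (by norm_num) _
    _ ≤ 2 := by norm_num

/-- **The `C²` size of an ADMISSIBLE frame**: `FrameOK R U N μ K` (multiscale piece bounds `‖Dʲ(Kp n)‖ ≤ Gfr j·uPow j U·4^{(j-2)n}`) gives,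
for `j ≤ 2` and every `p`, `‖Dʲ(frameShift K)(p)‖ ≤ 2·Gfr 0·|U| + 2·Gfr 1·U² + Gfr 2·U²·(N+1)` — geometric in `n` at orders `0, 1`, linear
in the number of scales at order `2` (the dispersion's second derivative does not decay along the flow; BGM (2.36)). -/
theorem norm_iteratedFDeriv_frameShift_le_of_frameOK {R : RenConsts} (hR : ∀ j, 0 ≤ R.Gfr j) {U : ℝ} {N : ℕ} {μ : ℝ}
    {K : TrigPolyC4v} (hK : FrameOK R U N μ K) (p : Momentum) {j : ℕ} (hj : j ≤ 2) :
    ‖iteratedFDeriv ℝ j (frameShift K) p‖ ≤ 2 * R.Gfr 0 * |U| + 2 * R.Gfr 1 * U ^ 2 + R.Gfr 2 * U ^ 2 * ((N : ℝ) + 1) := by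
  obtain ⟨-, Kp, hsum, hS⟩ := hK
  have hfs : frameShift K = fun q => ∑ n ∈ range (N + 1), (fun q => -evalM (Kp n) q) q := by
    funext q
    simp only [frameShift, evalM, hsum (WithLp.ofLp q), Finset.sum_neg_distrib]
  have hD : ‖iteratedFDeriv ℝ j (frameShift K) p‖ ≤
      ∑ n ∈ range (N + 1), R.Gfr j * uPow j U * (4 : ℝ) ^ (((j : ℤ) - 2) * n) := by
    rw [hfs, iteratedFDeriv_fun_sum_apply fun n _ => ((contDiff_evalM (Kp n)).neg).contDiffAt]
    refine (norm_sum_le _ _).trans (sum_le_sum fun n hn => ?_)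
    have hn' : n ≤ N := Nat.lt_succ_iff.mp (mem_range.mp hn)
    have h := hS n hn' j (by omega) p
    have e : (fun q => -evalM (Kp n) q) = -evalM (Kp n) := rfl
    rw [e, iteratedFDeriv_neg_apply, norm_neg]
    exact h
  have h0 := hR 0; have h1 := hR 1; have h2 := hR 2
  have hU2 : 0 ≤ U ^ 2 := sq_nonneg U
  have hUa : 0 ≤ |U| := abs_nonneg U
  have hN : (0 : ℝ) ≤ (N : ℝ) + 1 := by positivity
  interval_cases j
  · have hs : ∑ n ∈ range (N + 1), R.Gfr 0 * uPow 0 U * (4 : ℝ) ^ ((((0 : ℕ) : ℤ) - 2) * n) ≤ 2 * R.Gfr 0 * |U| := by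
      rw [← Finset.mul_sum]
      have := sum_four_zpow_le_two (j := 0) (by norm_num) N
      simp only [uPow, if_true] at *
      nlinarith [mul_nonneg h0 hUa]
    nlinarith [hD, hs, mul_nonneg h1 hU2, mul_nonneg (mul_nonneg h2 hU2) hN]
  · have hs : ∑ n ∈ range (N + 1), R.Gfr 1 * uPow 1 U * (4 : ℝ) ^ ((((1 : ℕ) : ℤ) - 2) * n) ≤ 2 * R.Gfr 1 * U ^ 2 := by
      rw [← Finset.mul_sum]
      have := sum_four_zpow_le_two (j := 1) le_rfl N
      simp only [uPow, one_ne_zero, if_false] at *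
      nlinarith [mul_nonneg h1 hU2]
    nlinarith [hD, hs, mul_nonneg h0 hUa, mul_nonneg (mul_nonneg h2 hU2) hN]
  · have hs : ∑ n ∈ range (N + 1), R.Gfr 2 * uPow 2 U * (4 : ℝ) ^ ((((2 : ℕ) : ℤ) - 2) * n) =
        R.Gfr 2 * U ^ 2 * ((N : ℝ) + 1) := by
      simp [uPow]; ring
    nlinarith [hD, hs, mul_nonneg h0 hUa, mul_nonneg h1 hU2]

/-- **In the multiscale regime `klBetaMin ≤ β ≤ e^{c/U²}`: `U²·(nScales β + 1) ≤ c / log 4`** (`isKLRegime_of_le_nScales_succ` at the last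
scale). -/
theorem sq_mul_nScales_succ_le {U c β : ℝ} (hc : 0 ≤ c) (hβmin : klBetaMin ≤ β) (hβc : β ≤ Real.exp (c / U ^ 2)) :
    U ^ 2 * ((nScales β : ℝ) + 1) ≤ c / Real.log 4 := by
  have h := isKLRegime_of_le_nScales_succ (n := nScales β + 1) hc hβmin hβc le_rfl
  unfold IsKLRegime at h
  have hlog : 0 < Real.log 4 := Real.log_pos (by norm_num)
  have habs : |(((-((nScales β + 1 : ℕ) : ℤ)) : ℤ) : ℝ)| = (nScales β : ℝ) + 1 := by
    rw [Int.cast_neg, Int.cast_natCast, abs_neg]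
    push_cast
    exact abs_of_nonneg (by positivity)
  rw [habs] at h
  rw [le_div_iff₀ hlog]
  linarith

/-- **The `C²` size of an admissible frame in the KL regime**: `FrameOK R U (nScales β) μ K` with `klBetaMin ≤ β ≤ e^{c/U²}` gives
`‖Dʲ(frameShift K)‖ ≤ 2·Gfr 0·|U| + 2·Gfr 1·U² + Gfr 2·c/log 4` (`j ≤ 2`) — uniformly in `β`; small for small `U` AND small `c`. -/
theorem norm_iteratedFDeriv_frameShift_le_of_frameOK_regime {R : RenConsts} (hR : ∀ j, 0 ≤ R.Gfr j) {U c β μ : ℝ}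
    (hc : 0 ≤ c) (hβmin : klBetaMin ≤ β) (hβc : β ≤ Real.exp (c / U ^ 2))
    {K : TrigPolyC4v} (hK : FrameOK R U (nScales β) μ K) (p : Momentum) {j : ℕ} (hj : j ≤ 2) :
    ‖iteratedFDeriv ℝ j (frameShift K) p‖ ≤ 2 * R.Gfr 0 * |U| + 2 * R.Gfr 1 * U ^ 2 + R.Gfr 2 * (c / Real.log 4) := by
  have h := norm_iteratedFDeriv_frameShift_le_of_frameOK hR hK p hj
  have h2 := sq_mul_nScales_succ_le hc hβmin hβc
  nlinarith [hR 2]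

/-- **Thresholds**: for `κ > 0` there are `c₃, U₀ > 0` (explicit in `R`, `κ`) with `4·(2·Gfr 0·U + 2·Gfr 1·U² + Gfr 2·c/log 4) ≤ κ` for
all `0 < U ≤ U₀`, `0 ≤ c ≤ c₃`. -/
theorem frame_thresholds {R : RenConsts} (hR : ∀ j, 0 ≤ R.Gfr j) {κ : ℝ} (hκ : 0 < κ) :
    ∃ c₃ : ℝ, 0 < c₃ ∧ ∃ U₀ : ℝ, 0 < U₀ ∧ ∀ c U : ℝ, 0 ≤ c → c ≤ c₃ → 0 < U → U ≤ U₀ →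
      4 * (2 * R.Gfr 0 * |U| + 2 * R.Gfr 1 * U ^ 2 + R.Gfr 2 * (c / Real.log 4)) ≤ κ := by
  have h0 := hR 0; have h1 := hR 1; have h2 := hR 2
  have hlog : 1 ≤ Real.log 4 := by
    have := Real.add_one_le_exp (1 : ℝ)
    have h4 : Real.exp 1 ≤ 4 := by
      have := Real.exp_one_lt_d9; norm_num at this; linarith
    calc (1 : ℝ) = Real.log (Real.exp 1) := (Real.log_exp 1).symm
      _ ≤ Real.log 4 := Real.log_le_log (Real.exp_pos 1) h4
  refine ⟨κ / (12 * (R.Gfr 2 + 1)), by positivity, min 1 (κ / (24 * (R.Gfr 0 + R.Gfr 1 + 1))),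
    lt_min one_pos (by positivity), ?_⟩
  intro c U hc hcle hU hUle
  have hU1 : U ≤ 1 := hUle.trans (min_le_left _ _)
  have hUk : U ≤ κ / (24 * (R.Gfr 0 + R.Gfr 1 + 1)) := hUle.trans (min_le_right _ _)
  have hUabs : |U| = U := abs_of_pos hU
  rw [hUabs]
  have hU2 : U ^ 2 ≤ U := by nlinarith
  have hA : 2 * R.Gfr 0 * U + 2 * R.Gfr 1 * U ^ 2 ≤ 2 * (R.Gfr 0 + R.Gfr 1 + 1) * U := by nlinarith
  have hB : 2 * (R.Gfr 0 + R.Gfr 1 + 1) * U ≤ κ / 12 := by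
    have hpos : 0 < 24 * (R.Gfr 0 + R.Gfr 1 + 1) := by positivity
    have := (le_div_iff₀ hpos).mp hUk
    linarith
  have hC : R.Gfr 2 * (c / Real.log 4) ≤ R.Gfr 2 * c := by
    apply mul_le_mul_of_nonneg_left _ h2
    exact div_le_self hc hlog
  have hD : R.Gfr 2 * c ≤ κ / 12 := by
    have hpos : 0 < 12 * (R.Gfr 2 + 1) := by positivity
    have := (le_div_iff₀ hpos).mp hcle
    nlinarith
  linarith

end Summit.HubbardSuperconductivity.HubbardSuperconductivity.Theorems.PerturbedFermiCurve

end
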